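import Literature.Analysis.FluidPDE.NSGalerkinFourier
import HarnessLib

/-!
# The windy fixed-point map at Galerkin level (route WindLine, support `WindyShoreUniform`)

Helper file for `Summits/AnomalousDissipation/AnomalousDissipation/Theorems/WindLineWindyShoreUniform`
(item stmt-AnomalousDissipation-11419). For a finite frequency set `S ∋ 0`, a coefficient vector
`c : S → ℂ³` splits as wake plus mean mode, `c = c̃ ⊕ c₀`, and the convection symbol splits as
`B(c,c)_k = B̃(c̃,c̃)_k + 2πi (c₀·k) c̃_k` (`convectionCoeff_coeffExt_split`): a real mean mode
`c₀ = s·e` convects the wake as a uniform wind, and nothing convects into the mean mode. With the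
**wind multiplier** `M_k = 4π²ν|k|² + 2πi s(e·k)`, `|M_k| ≥ 2π|s||e·k|` uniformly in `ν`
(`advection_le_norm_mult`), the windy steady Galerkin equations become the fixed-point problem
of `Φ(c)_0 = s·e`, `Φ(c)_k = M_k⁻¹ Π_k (g_k − B̃(c̃,c̃)_k)` (`k ≠ 0`). The wake map `W`, the
multiplier `M` and the map `Φ` enter every statement through their defining equations (`hW`,
`hM`, `hΦ`); this file declares no definitions. Proved here: `Φ` preserves real divergence-free
vectors (`Phi_mem`), the sup-norm bound of its wake (`norm_wake_Phi_le`) and its Lipschitz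
estimate on wake balls (`norm_Phi_sub_Phi_le`), from the algebra and the crude bound
`norm_convectionCoeff_le` of `NSGalerkinFourier` (Robinson–Rodrigo–Sadowski 2016, §4.1, (4.5);
Constantin–Foias 1988, Ch. 8, (8.5); Temam 1979, Ch. II, §1, Thm. 1.3: steady states by
contraction, here with the wind `s` as the large parameter).
-/


set_option linter.dupNamespace false

open scoped BigOperators ComplexConjugate
open Literature.Analysis.FluidPDE Literature.Analysis.FluidPDE.Torus
open Literature.Analysis.FunctionSpaces Literature.Analysis.FunctionSpaces.Torus

namespace Summit.AnomalousDissipation.AnomalousDissipation.Theorems.WindLine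

variable {S : Finset (Fin 3 → ℤ)}

/-! ## The wake of a coefficient vector -/

section Wake

variable {W : (↥S → EuclideanSpace ℂ (Fin 3)) → ↥S → EuclideanSpace ℂ (Fin 3)}
  (hW : ∀ c k, W c k = if (k : Fin 3 → ℤ) = 0 then 0 else c k)
include hW

/-- The wake vanishes at the mean mode. [folklore] -/
theorem wake_of_eq_zero (c : ↥S → EuclideanSpace ℂ (Fin 3)) {k : ↥S} (hk : (k : Fin 3 → ℤ) = 0) :
    W c k = 0 := by
  rw [hW, if_pos hk]

/-- The wake agrees with the vector away from the mean mode. [folklore] -/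
theorem wake_of_ne_zero (c : ↥S → EuclideanSpace ℂ (Fin 3)) {k : ↥S} (hk : (k : Fin 3 → ℤ) ≠ 0) :
    W c k = c k := by
  rw [hW, if_neg hk]

/-- The wake map is additive (indeed linear); here: it respects differences. [folklore] -/
theorem wake_sub (c c' : ↥S → EuclideanSpace ℂ (Fin 3)) : W c - W c' = W (c - c') := by
  funext k
  by_cases hk : (k : Fin 3 → ℤ) = 0 <;> simp [hW, hk]

/-- Coordinates of the wake are bounded by those of the vector. [folklore] -/
theorem norm_wake_apply_le (c : ↥S → EuclideanSpace ℂ (Fin 3)) (k : ↥S) : ‖W c k‖ ≤ ‖c k‖ := by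
  by_cases hk : (k : Fin 3 → ℤ) = 0
  · rw [wake_of_eq_zero hW c hk, norm_zero]; exact norm_nonneg _
  · rw [wake_of_ne_zero hW c hk]

/-- The wake map is a contraction for the sup norm. [folklore] -/
theorem norm_wake_le (c : ↥S → EuclideanSpace ℂ (Fin 3)) : ‖W c‖ ≤ ‖c‖ :=
  (pi_norm_le_iff_of_nonneg (norm_nonneg c)).2 fun k =>
    (norm_wake_apply_le hW c k).trans (norm_le_pi_norm c k)

/-- Squared coordinates of the wake: the wake energy summand. [folklore] -/
theorem norm_wake_apply_sq (c : ↥S → EuclideanSpace ℂ (Fin 3)) (k : ↥S) :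
    ‖W c k‖ ^ 2 = if (k : Fin 3 → ℤ) = 0 then 0 else ‖c k‖ ^ 2 := by
  by_cases hk : (k : Fin 3 → ℤ) = 0
  · rw [wake_of_eq_zero hW c hk, if_pos hk, norm_zero]; ring
  · rw [wake_of_ne_zero hW c hk, if_neg hk]

/-- The wake energy dominates the squared sup norm of the wake. [folklore] -/
theorem norm_wake_sq_le (c : ↥S → EuclideanSpace ℂ (Fin 3)) :
    ‖W c‖ ^ 2 ≤ ∑ k : ↥S, (if (k : Fin 3 → ℤ) = 0 then 0 else ‖c k‖ ^ 2) := by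
  refine (norm_sq_le_sum_norm_sq (W c)).trans (le_of_eq ?_)
  exact Finset.sum_congr rfl fun k _ => norm_wake_apply_sq hW c k

/-- The wake energy is at most `#S` times the squared sup norm of the wake. [folklore] -/
theorem wakeEnergy_le (c : ↥S → EuclideanSpace ℂ (Fin 3)) :
    ∑ k : ↥S, (if (k : Fin 3 → ℤ) = 0 then 0 else ‖c k‖ ^ 2) ≤ S.card * ‖W c‖ ^ 2 := by
  refine (le_of_eq ?_).trans (sum_norm_sq_le_card_mul_norm_sq (W c))
  exact Finset.sum_congr rfl fun k _ => (norm_wake_apply_sq hW c k).symm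

/-- The wake of a real coefficient vector is real. [folklore] -/
theorem isRealCoeff_wake {c : ↥S → EuclideanSpace ℂ (Fin 3)} (hc : IsRealCoeff c) :
    IsRealCoeff (W c) := by
  intro k l h
  by_cases hk : (k : Fin 3 → ℤ) = 0
  · have hl : (l : Fin 3 → ℤ) = 0 := by rw [h, hk, neg_zero]
    rw [wake_of_eq_zero hW c hk, wake_of_eq_zero hW c hl, EuclideanSpace.conjVec_zero]
  · have hl : (l : Fin 3 → ℤ) ≠ 0 := fun hl =>
      hk (by rw [← neg_neg (k : Fin 3 → ℤ), ← h, hl, neg_zero])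
    rw [wake_of_ne_zero hW c hk, wake_of_ne_zero hW c hl, hc k l h]

end Wake

/-! ## Splitting of the convection symbol along wake ⊕ mean mode -/

/-- Convection *into* a vector supported at the mean mode vanishes: the symbol `(x_l·m) z_m` has
`m = 0` or `z_m = 0`. [folklore] -/
theorem convectionCoeff_meanMode_right (x : (Fin 3 → ℤ) → EuclideanSpace ℂ (Fin 3))
    {z : ↥S → EuclideanSpace ℂ (Fin 3)} (hz : ∀ m : ↥S, (m : Fin 3 → ℤ) ≠ 0 → z m = 0)
    (k : Fin 3 → ℤ) : convectionCoeff S x (coeffExt S z) k = 0 := by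
  rw [convectionCoeff_def]
  refine Finset.sum_eq_zero fun l _ => Finset.sum_eq_zero fun m hm => ?_
  split_ifs with hlm
  · by_cases hm0 : m = 0
    · subst hm0
      simp
    · rw [coeffExt_of_mem _ hm, hz ⟨m, hm⟩ hm0, smul_zero]
  · rfl

/-- Convection *by* a vector supported at the mean mode is a uniform wind:
`∑_{l+m=k} (z_l·m) w_m = (z_0·k) w_k`. [folklore] -/
theorem convectionCoeff_meanMode_left {z : ↥S → EuclideanSpace ℂ (Fin 3)}
    (hz : ∀ m : ↥S, (m : Fin 3 → ℤ) ≠ 0 → z m = 0) (w : ↥S → EuclideanSpace ℂ (Fin 3))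
    (h0 : (0 : Fin 3 → ℤ) ∈ S) (k : Fin 3 → ℤ) :
    convectionCoeff S (coeffExt S z) (coeffExt S w) k =
      (2 * Real.pi * Complex.I * ∑ j, z ⟨0, h0⟩ j * (k j : ℂ)) • coeffExt S w k := by
  rw [convectionCoeff_def, Finset.sum_eq_single_of_mem (0 : Fin 3 → ℤ) h0]
  · simp_rw [zero_add]
    rw [Finset.sum_ite_eq' S k]
    by_cases hk : k ∈ S
    · rw [if_pos hk, coeffExt_of_mem _ h0]
    · rw [if_neg hk, coeffExt_of_not_mem _ hk, smul_zero]
  · intro l hl hl0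
    refine Finset.sum_eq_zero fun m _ => ?_
    split_ifs
    · rw [coeffExt_of_mem _ hl, hz ⟨l, hl⟩ hl0]
      simp
    · rfl

/-- The mean output of the convection symbol vanishes for conjugate-symmetric transversal
coefficients: `∑_{m} (2πi c(-m)·m) c m = 0` since `c(-m)·m = conj (m · c m) = 0`. [folklore] -/
theorem convectionCoeff_zero_eq_zero {c : (Fin 3 → ℤ) → EuclideanSpace ℂ (Fin 3)}
    (hc : IsConjSymm c) (hcT : IsTransversal S c) : convectionCoeff S c c 0 = 0 := by
  -- adapted from Literature/Barriers/AnomalousDissipation/GravestModeLaminarAttractorGalerkin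
  rw [convectionCoeff_def]
  refine Finset.sum_eq_zero fun l _ => Finset.sum_eq_zero fun m hm => ?_
  split_ifs with hlm
  · have hl' : l = -m := eq_neg_of_add_eq_zero_left hlm
    subst hl'
    have h : ∑ j, c (-m) j * (m j : ℂ) = 0 := by
      rw [hc m]
      simp only [EuclideanSpace.conjVec_apply]
      have := congr_arg (starRingEnd ℂ) (hcT m hm)
      rw [map_sum, map_zero] at this
      rw [← this]
      refine Finset.sum_congr rfl fun j _ => ?_
      rw [map_mul, map_intCast, mul_comm]
    rw [h, mul_zero, zero_smul]
  · rfl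

section WakeConv

variable {W : (↥S → EuclideanSpace ℂ (Fin 3)) → ↥S → EuclideanSpace ℂ (Fin 3)}

/-- **Splitting of the convection symbol** along `c = c̃ ⊕ c₀`:
`B(c, c)_k = B̃(c̃, c̃)_k + 2πi (c₀·k) c̃_k` (the mean mode convects the wake as a uniform wind;
nothing convects into the mean mode). [folklore] -/
theorem convectionCoeff_coeffExt_split (hW : ∀ c k, W c k = if (k : Fin 3 → ℤ) = 0 then 0 else c k)
    (h0 : (0 : Fin 3 → ℤ) ∈ S) (c : ↥S → EuclideanSpace ℂ (Fin 3)) (k : Fin 3 → ℤ) :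
    convectionCoeff S (coeffExt S c) (coeffExt S c) k =
      convectionCoeff S (coeffExt S (W c)) (coeffExt S (W c)) k +
        (2 * Real.pi * Complex.I * ∑ j, c ⟨0, h0⟩ j * (k j : ℂ)) • coeffExt S (W c) k := by
  set z : ↥S → EuclideanSpace ℂ (Fin 3) := c - W c with hz
  have hzs : ∀ m : ↥S, (m : Fin 3 → ℤ) ≠ 0 → z m = 0 := fun m hm => by
    simp [hz, hW, hm]
  have hz0 : z ⟨0, h0⟩ = c ⟨0, h0⟩ := by simp [hz, hW]
  have hc : c = W c + z := by rw [hz, add_sub_cancel]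
  conv_lhs => rw [hc, coeffExt_add]
  rw [convectionCoeff_add_left, convectionCoeff_add_right, convectionCoeff_add_right,
    convectionCoeff_meanMode_right _ hzs, convectionCoeff_meanMode_right _ hzs, add_zero, add_zero,
    convectionCoeff_meanMode_left hzs _ h0, hz0]

/-- **Crude bound** for the reduced convection symbol `B̃(c̃,c̃)`:
`‖B̃(c̃,c̃)_k‖ ≤ 2π (#S ∑_{m∈S}∑ⱼ|mⱼ|) ‖c̃‖_∞²`. [folklore] -/
theorem norm_wakeConv_le (c : ↥S → EuclideanSpace ℂ (Fin 3)) (k : Fin 3 → ℤ) :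
    ‖convectionCoeff S (coeffExt S (W c)) (coeffExt S (W c)) k‖ ≤
      2 * Real.pi * (S.card * ∑ m ∈ S, ∑ j, |(m j : ℝ)|) * ‖W c‖ * ‖W c‖ :=
  norm_convectionCoeff_le S (fun l _ => norm_coeffExt_le _ l) (fun m _ => norm_coeffExt_le _ m) k

/-- **Lipschitz bound** for the reduced convection symbol on sup-norm balls:
`‖B̃(c̃,c̃)_k − B̃(c̃',c̃')_k‖ ≤ 2π (#S ∑_{m∈S}∑ⱼ|mⱼ|) (‖c̃‖_∞ + ‖c̃'‖_∞) ‖c̃ − c̃'‖_∞`. [folklore] -/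
theorem norm_wakeConv_sub_le (c c' : ↥S → EuclideanSpace ℂ (Fin 3)) (k : Fin 3 → ℤ) :
    ‖convectionCoeff S (coeffExt S (W c)) (coeffExt S (W c)) k -
        convectionCoeff S (coeffExt S (W c')) (coeffExt S (W c')) k‖ ≤
      2 * Real.pi * (S.card * ∑ m ∈ S, ∑ j, |(m j : ℝ)|) * (‖W c‖ + ‖W c'‖) * ‖W c - W c'‖ := by
  rw [convectionCoeff_self_sub_self]
  refine (norm_add_le _ _).trans ?_
  have hdl : ∀ l ∈ S, ‖(coeffExt S (W c) - coeffExt S (W c')) l‖ ≤ ‖W c - W c'‖ :=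
    fun l _ => by rw [← coeffExt_sub]; exact norm_coeffExt_le _ l
  have hb1 := norm_convectionCoeff_le S hdl (fun m _ => norm_coeffExt_le (W c) m) k
  have hb2 := norm_convectionCoeff_le S (fun m _ => norm_coeffExt_le (W c') m) hdl k
  calc _ ≤ _ := add_le_add hb1 hb2
    _ = _ := by ring

/-- The reduced convection symbol of a real vector is conjugate symmetric (on symmetric `S`).
[folklore] -/
theorem isConjSymm_wakeConv (hW : ∀ c k, W c k = if (k : Fin 3 → ℤ) = 0 then 0 else c k)
    (hS : ∀ k ∈ S, -k ∈ S) {c : ↥S → EuclideanSpace ℂ (Fin 3)} (hc : IsRealCoeff c) :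
    IsConjSymm (convectionCoeff S (coeffExt S (W c)) (coeffExt S (W c))) :=
  ((isRealCoeff_wake hW hc).isConjSymm_coeffExt hS).convectionCoeff hS
    ((isRealCoeff_wake hW hc).isConjSymm_coeffExt hS)

end WakeConv

/-! ## The wind multiplier and the non-resonance gap -/

section Mult

variable {ν s : ℝ} {e : EuclideanSpace ℝ (Fin 3)} {M : (Fin 3 → ℤ) → ℂ}
  (hM : ∀ k, M k = ((ν * (4 * Real.pi ^ 2 * freqNormSq k) : ℝ) : ℂ) +
    2 * Real.pi * Complex.I * ((s * ∑ i, e i * (k i : ℝ) : ℝ) : ℂ))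
include hM

/-- The imaginary part of the wind multiplier `M_k = 4π²ν|k|² + 2πi s(e·k)` is the advection
`2π s (e·k)`. [folklore] -/
theorem mult_im (k : Fin 3 → ℤ) : (M k).im = 2 * Real.pi * (s * ∑ i, e i * (k i : ℝ)) := by
  have h : (2 * (Real.pi : ℂ) * Complex.I * ((s * ∑ i, e i * (k i : ℝ) : ℝ) : ℂ)) =
      ((2 * Real.pi * (s * ∑ i, e i * (k i : ℝ)) : ℝ) : ℂ) * Complex.I := by
    push_cast; ring
  rw [hM, Complex.add_im, Complex.ofReal_im, zero_add, h]
  simp [Complex.mul_im]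

/-- **The multiplier dominates the advection, uniformly in `ν`**: `2π|s||e·k| ≤ |M_k|` (the sign
of `ν` is not used). [folklore] -/
theorem advection_le_norm_mult (k : Fin 3 → ℤ) :
    2 * Real.pi * (|s| * |∑ i, e i * (k i : ℝ)|) ≤ ‖M k‖ := by
  have h := Complex.abs_im_le_norm (M k)
  rw [mult_im hM] at h
  calc 2 * Real.pi * (|s| * |∑ i, e i * (k i : ℝ)|)
        = |2 * Real.pi * (s * ∑ i, e i * (k i : ℝ))| := by
          rw [abs_mul (2 * Real.pi) (s * _), abs_mul s, abs_of_pos Real.two_pi_pos]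
    _ ≤ _ := h

/-- The multiplier is conjugate-odd in the frequency: `M_{-k} = conj M_k`. [folklore] -/
theorem mult_neg (k : Fin 3 → ℤ) : M (-k) = conj (M k) := by
  have hodd : ∑ i, e i * ((-k) i : ℝ) = -∑ i, e i * (k i : ℝ) := by
    simp [Finset.sum_neg_distrib, mul_neg]
  simp only [hM, freqNormSq_neg, hodd, map_add, Complex.conj_ofReal, map_mul, Complex.conj_I,
    map_ofNat]
  push_cast
  ring

end Mult

/-- **The non-resonance gap**: on the finite set `S ∖ 0` the pairing `|e·k|` is bounded below by
some `δ > 0`. [folklore] -/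
theorem exists_gap (e : EuclideanSpace ℝ (Fin 3))
    (he : ∀ k : ↥S, (k : Fin 3 → ℤ) ≠ 0 → ∑ i, e i * ((k : Fin 3 → ℤ) i : ℝ) ≠ 0) :
    ∃ δ : ℝ, 0 < δ ∧ ∀ k : ↥S, (k : Fin 3 → ℤ) ≠ 0 → δ ≤ |∑ i, e i * ((k : Fin 3 → ℤ) i : ℝ)| := by
  classical
  set T : Finset ↥S := Finset.univ.filter fun k => (k : Fin 3 → ℤ) ≠ 0 with hT
  by_cases hne : T.Nonempty
  · obtain ⟨k₀, hk₀, hmin⟩ := T.exists_min_image (fun k => |∑ i, e i * ((k : Fin 3 → ℤ) i : ℝ)|) hne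
    refine ⟨_, abs_pos.2 (he k₀ (Finset.mem_filter.1 hk₀).2), fun k hk => hmin k ?_⟩
    exact Finset.mem_filter.2 ⟨Finset.mem_univ _, hk⟩
  · refine ⟨1, one_pos, fun k hk => ?_⟩
    exact absurd ⟨k, Finset.mem_filter.2 ⟨Finset.mem_univ _, hk⟩⟩ hne

/-! ## The fixed-point map -/

/-- The complexification of a real vector is real. [folklore] -/
theorem conjVec_complexify (e : EuclideanSpace ℝ (Fin 3)) :
    EuclideanSpace.conjVec (EuclideanSpace.complexify e) = EuclideanSpace.complexify e := by
  ext i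
  simp

/-- The wind `s·e` is a real vector. [folklore] -/
theorem conjVec_wind (s : ℝ) (e : EuclideanSpace ℝ (Fin 3)) :
    EuclideanSpace.conjVec ((s : ℂ) • EuclideanSpace.complexify e) =
      (s : ℂ) • EuclideanSpace.complexify e := by
  rw [EuclideanSpace.conjVec_smul, Complex.conj_ofReal, conjVec_complexify]

section Phi

variable {ν s : ℝ} {e : EuclideanSpace ℝ (Fin 3)} {g : ↥S → EuclideanSpace ℂ (Fin 3)}
  {W : (↥S → EuclideanSpace ℂ (Fin 3)) → ↥S → EuclideanSpace ℂ (Fin 3)} {M : (Fin 3 → ℤ) → ℂ}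
  {Φ : (↥S → EuclideanSpace ℂ (Fin 3)) → ↥S → EuclideanSpace ℂ (Fin 3)}
  (hW : ∀ c k, W c k = if (k : Fin 3 → ℤ) = 0 then 0 else c k)
  (hM : ∀ k, M k = ((ν * (4 * Real.pi ^ 2 * freqNormSq k) : ℝ) : ℂ) +
    2 * Real.pi * Complex.I * ((s * ∑ i, e i * (k i : ℝ) : ℝ) : ℂ))
  (hΦ : ∀ c k, Φ c k = if (k : Fin 3 → ℤ) = 0 then (s : ℂ) • EuclideanSpace.complexify e
    else (M k)⁻¹ • leraySym (k : Fin 3 → ℤ)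
      (g k - convectionCoeff S (coeffExt S (W c)) (coeffExt S (W c)) k))

include hΦ in
/-- The map at the mean mode: the wind. [folklore] -/
theorem Phi_of_eq_zero (c : ↥S → EuclideanSpace ℂ (Fin 3)) {k : ↥S} (hk : (k : Fin 3 → ℤ) = 0) :
    Φ c k = (s : ℂ) • EuclideanSpace.complexify e := by
  rw [hΦ, if_pos hk]

include hΦ in
/-- The map away from the mean mode: `Φ(c)_k = M_k⁻¹ Π_k (g_k − B̃(c̃,c̃)_k)`. [folklore] -/
theorem Phi_of_ne_zero (c : ↥S → EuclideanSpace ℂ (Fin 3)) {k : ↥S} (hk : (k : Fin 3 → ℤ) ≠ 0) :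
    Φ c k = (M k)⁻¹ • leraySym (k : Fin 3 → ℤ)
      (g k - convectionCoeff S (coeffExt S (W c)) (coeffExt S (W c)) k) := by
  rw [hΦ, if_neg hk]

include hW hM hΦ in
/-- **Invariance**: the map sends real vectors to real, divergence-free vectors (for a real
force on a symmetric `S`). [folklore] -/
theorem Phi_mem (hS : ∀ k ∈ S, -k ∈ S) (hg : g ∈ galerkinSubspace S)
    {c : ↥S → EuclideanSpace ℂ (Fin 3)} (hc : c ∈ galerkinSubspace S) :
    Φ c ∈ galerkinSubspace S := by
  refine ⟨?_, ?_⟩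
  · intro k l h
    by_cases hk : (k : Fin 3 → ℤ) = 0
    · have hl : (l : Fin 3 → ℤ) = 0 := by rw [h, hk, neg_zero]
      rw [Phi_of_eq_zero hΦ c hk, Phi_of_eq_zero hΦ c hl, conjVec_wind]
    · have hl : (l : Fin 3 → ℤ) ≠ 0 := fun hl =>
        hk (by rw [← neg_neg (k : Fin 3 → ℤ), ← h, hl, neg_zero])
      rw [Phi_of_ne_zero hΦ c hk, Phi_of_ne_zero hΦ c hl, EuclideanSpace.conjVec_smul, h,
        mult_neg hM, map_inv₀, leraySym_neg_freq, conjVec_leraySym, EuclideanSpace.conjVec_sub,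
        hg.1 k l h, isConjSymm_wakeConv hW hS hc.1 (k : Fin 3 → ℤ)]
  · intro k
    by_cases hk : (k : Fin 3 → ℤ) = 0
    · simp [hk]
    · rw [Phi_of_ne_zero hΦ c hk]
      have h := sum_mul_leraySym_apply (k : Fin 3 → ℤ)
        (g k - convectionCoeff S (coeffExt S (W c)) (coeffExt S (W c)) k)
      calc ∑ j, ((k : Fin 3 → ℤ) j : ℂ) * (((M k)⁻¹ • leraySym (k : Fin 3 → ℤ)
              (g k - convectionCoeff S (coeffExt S (W c)) (coeffExt S (W c)) k)) j)
          = (M k)⁻¹ * ∑ j, ((k : Fin 3 → ℤ) j : ℂ) * leraySym (k : Fin 3 → ℤ)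
              (g k - convectionCoeff S (coeffExt S (W c)) (coeffExt S (W c)) k) j := by
            rw [Finset.mul_sum]
            exact Finset.sum_congr rfl fun j _ => by rw [PiLp.smul_apply, smul_eq_mul]; ring
        _ = 0 := by rw [h, mul_zero]

include hW hΦ in
/-- The wake of the image is bounded by `β⁻¹ (‖g‖_∞ + L ‖c̃‖_∞²)` whenever `β ≤ |M_k|` on
`S ∖ 0`, `L = 2π #S ∑_{m∈S}∑ⱼ|mⱼ|`. [folklore] -/
theorem norm_wake_Phi_le {β L : ℝ} (hβ : 0 < β)
    (hβle : ∀ k : ↥S, (k : Fin 3 → ℤ) ≠ 0 → β ≤ ‖M k‖)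
    (hL : L = 2 * Real.pi * (S.card * ∑ m ∈ S, ∑ j, |(m j : ℝ)|))
    (c : ↥S → EuclideanSpace ℂ (Fin 3)) :
    ‖W (Φ c)‖ ≤ β⁻¹ * (‖g‖ + L * ‖W c‖ ^ 2) := by
  have hL0 : 0 ≤ L := by rw [hL]; positivity
  have hrhs : 0 ≤ β⁻¹ * (‖g‖ + L * ‖W c‖ ^ 2) := by positivity
  refine (pi_norm_le_iff_of_nonneg hrhs).2 fun k => ?_
  by_cases hk : (k : Fin 3 → ℤ) = 0
  · rw [wake_of_eq_zero hW _ hk, norm_zero]; exact hrhs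
  · rw [wake_of_ne_zero hW _ hk, Phi_of_ne_zero hΦ c hk, norm_smul, norm_inv]
    refine mul_le_mul (inv_anti₀ hβ (hβle k hk)) ?_ (norm_nonneg _) (inv_pos.2 hβ).le
    refine (norm_leraySym_le _ _).trans ((norm_sub_le _ _).trans (add_le_add
      (norm_le_pi_norm g k) ?_))
    calc _ ≤ L * ‖W c‖ * ‖W c‖ := by rw [hL]; exact norm_wakeConv_le c k
      _ = L * ‖W c‖ ^ 2 := by ring

include hW hΦ in
/-- **Lipschitz estimate** of the map on wake balls:
`‖Φ(c) − Φ(c')‖_∞ ≤ β⁻¹ L (‖c̃‖_∞ + ‖c̃'‖_∞) ‖c − c'‖_∞` whenever `β ≤ |M_k|` on `S ∖ 0`.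
[folklore] -/
theorem norm_Phi_sub_Phi_le {β L : ℝ} (hβ : 0 < β)
    (hβle : ∀ k : ↥S, (k : Fin 3 → ℤ) ≠ 0 → β ≤ ‖M k‖)
    (hL : L = 2 * Real.pi * (S.card * ∑ m ∈ S, ∑ j, |(m j : ℝ)|))
    (c c' : ↥S → EuclideanSpace ℂ (Fin 3)) :
    ‖Φ c - Φ c'‖ ≤ β⁻¹ * (L * (‖W c‖ + ‖W c'‖)) * ‖c - c'‖ := by
  have hL0 : 0 ≤ L := by rw [hL]; positivity
  have hrhs : 0 ≤ β⁻¹ * (L * (‖W c‖ + ‖W c'‖)) * ‖c - c'‖ := by positivity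
  refine (pi_norm_le_iff_of_nonneg hrhs).2 fun k => ?_
  by_cases hk : (k : Fin 3 → ℤ) = 0
  · rw [Pi.sub_apply, Phi_of_eq_zero hΦ c hk, Phi_of_eq_zero hΦ c' hk, sub_self, norm_zero]
    exact hrhs
  · rw [Pi.sub_apply, Phi_of_ne_zero hΦ c hk, Phi_of_ne_zero hΦ c' hk, ← smul_sub, norm_smul,
      norm_inv, ← leraySym_sub, sub_sub_sub_cancel_left, mul_assoc]
    refine mul_le_mul (inv_anti₀ hβ (hβle k hk)) ?_ (norm_nonneg _) (inv_pos.2 hβ).le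
    refine (norm_leraySym_le _ _).trans ?_
    rw [norm_sub_rev]
    refine (by rw [hL]; exact norm_wakeConv_sub_le c c' k : _ ≤ L * (‖W c‖ + ‖W c'‖) *
      ‖W c - W c'‖).trans ?_
    rw [wake_sub hW]
    exact mul_le_mul_of_nonneg_left (norm_wake_le hW _) (by positivity)

end Phi

end Summit.AnomalousDissipation.AnomalousDissipation.Theorems.WindLine
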